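import Mathlib
import HarnessLib
import Literature.Analysis.PDE.DivFormLiouville
import Literature.Analysis.FunctionSpaces.SmoothCutoff
import Summits.NavierStokesRegularity.NavierStokesRegularity.Theorems.PoloidalWindowDoorPoloidalWindowRigidityDivFormReverseHolder

/-!
# Route `PoloidalWindowDoor`, crux K2 (stmt-NavierStokesRegularity-19708) — task H5, step M3b: Moser's REVERSE HÖLDER STEP
# in `eLpNorm` form for `div(a∇u) = 0`, `n ≥ 3` (towards `divFormLiouville_holds`, De Giorgi–Nash–Moser)

Seat ns-poloidal-K2-p3 g2 (`ledger fact claim` #1 on `Literature.Analysis.PDE.divFormLiouville`; setting = that fact's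
rendering, `w ≥ 1` an entire `C¹` weak solution).  Moser 1961 §4 / Gilbarg–Trudinger Thm 8.18: the energy bound of M3a
(`energy_testPow_le`) and the Gagliardo–Nirenberg–Sobolev inequality (Mathlib `eLpNorm_le_eLpNorm_fderiv_of_eq_inner`, `p = 2`,
`2* = 2n/(n−2)`) give, for `f = w^σ` (`σ = ±1`), `p > 0` with `σp ≠ 1`, concentric closed balls `B̄(x₀,ρ') ⊂ B̄(x₀,ρ)` and
`κ = n/(n−2)`:
`‖f‖_{L^{pκ}(B̄(x₀,ρ'))} ≤ (C_S² M)^{1/p} ‖f‖_{L^p(B̄(x₀,ρ))}`, `M = 2((q/(q−1))²nΛ + λ)/λ · (C₀/(ρ−ρ'))²`, `q = σp`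
— exactly the hypothesis shape of the tree's `Literature.Analysis.FunctionSpaces.eLpNorm_top_le_of_moser_chain`.

* `exists_closedBall_cutoff` — two-radius cutoffs equal to `1` on the CLOSED inner ball;
* `eLpNorm_rpow_eq` — `‖w^s‖_{L^r} = (∫⁻ w^{sr})^{1/r}` for `w > 0`;
* `moser_step` — the displayed reverse Hölder inequality.

WHAT THIS IS NOT: not yet the Liouville theorem (M3c chain, M4 Harnack ⇒ Liouville to come); nothing NS-specific.
-/

noncomputable section

open MeasureTheory Set Function Filter Topology Metric Module
open scoped Matrix ENNReal NNReal

-- the summit and its single sub-problem share the name (CONVENTIONS §1), as in every Theorems file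
set_option linter.dupNamespace false

namespace Summit.NavierStokesRegularity.NavierStokesRegularity.Theorems.PoloidalWindowDoorPoloidalWindowRigidityDivFormMoserStep

open Summit.NavierStokesRegularity.NavierStokesRegularity.Theorems.PoloidalWindowDoorPoloidalWindowRigidityDivFormCaccioppoli
open Summit.NavierStokesRegularity.NavierStokesRegularity.Theorems.PoloidalWindowDoorPoloidalWindowRigidityDivFormReverseHolder
open Literature.Analysis.FunctionSpaces

variable {n : ℕ}

/-! ### Cutoffs equal to one on a closed ball -/

/-- **Two-radius cutoffs, closed inner ball.**  There is `C₀ ≥ 0` such that for all `x₀` and `0 < ρ' < ρ` there is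
`χ ∈ C¹_c(ℝⁿ)`, `0 ≤ χ ≤ 1`, `χ = 1` on `B̄(x₀,ρ')`, `χ = 0` off `B(x₀,ρ)`, `‖Dχ‖ ≤ C₀/(ρ − ρ')`. -/
theorem exists_closedBall_cutoff (n : ℕ) : ∃ C₀ : ℝ, 0 ≤ C₀ ∧ ∀ (x₀ : EuclideanSpace ℝ (Fin n)) (ρ' ρ : ℝ),
    0 < ρ' → ρ' < ρ →
    ∃ χ : EuclideanSpace ℝ (Fin n) → ℝ, ContDiff ℝ 1 χ ∧ HasCompactSupport χ ∧ (∀ x, 0 ≤ χ x ∧ χ x ≤ 1) ∧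
      (∀ x ∈ closedBall x₀ ρ', χ x = 1) ∧ (∀ x, x ∉ ball x₀ ρ → χ x = 0) ∧ ∀ x, ‖fderiv ℝ χ x‖ ≤ C₀ / (ρ - ρ') := by
  obtain ⟨C, hC0, hC⟩ := exists_smooth_cutoff (volume : Measure (EuclideanSpace ℝ (Fin n)))
  refine ⟨2 * C, by positivity, fun x₀ ρ' ρ hρ' hρ => ?_⟩
  have hδ : 0 < (ρ - ρ') / 2 := by linarith
  obtain ⟨χ, hχs, hχ01, hχ1, hχ0, hχD⟩ := hC (ball x₀ ((ρ + ρ') / 2)) measurableSet_ball ((ρ - ρ') / 2) hδ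
  have hzero : ∀ x, x ∉ ball x₀ ρ → χ x = 0 := by
    intro x hx
    refine hχ0 x (Metric.ball_disjoint_ball ?_)
    rw [mem_ball, not_lt] at hx
    linarith
  refine ⟨χ, hχs.of_le (by norm_cast), ?_, hχ01, fun x hx => hχ1 x ?_, hzero,
    fun x => (hχD x).trans_eq (by field_simp)⟩
  · refine HasCompactSupport.intro (isCompact_closedBall x₀ ρ) fun x hx => hzero x fun hx' => hx ?_
    exact ball_subset_closedBall hx'
  · rw [mem_closedBall] at hx
    intro z hz
    rw [mem_ball] at hz ⊢
    calc dist z x₀ ≤ dist z x + dist x x₀ := dist_triangle _ _ _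
      _ < (ρ - ρ') / 2 + ρ' := by linarith
      _ = (ρ + ρ') / 2 := by ring

/-! ### `eLpNorm` of powers -/

/-- `‖w^s‖_{L^r(μ)} = (∫⁻ w^{sr} dμ)^{1/r}` for `w > 0`, `r > 0`. -/
theorem eLpNorm_rpow_eq {α : Type*} [MeasurableSpace α] (μ : Measure α) {w : α → ℝ} (hw : ∀ x, 0 < w x) (s : ℝ)
    {r : ℝ} (hr : 0 < r) :
    eLpNorm (fun x => w x ^ s) (ENNReal.ofReal r) μ = (∫⁻ x, ENNReal.ofReal (w x ^ (s * r)) ∂μ) ^ (1 / r) := by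
  rw [eLpNorm_eq_lintegral_rpow_enorm_toReal (ENNReal.ofReal_pos.2 hr).ne' ENNReal.ofReal_ne_top,
    ENNReal.toReal_ofReal hr.le]
  congr 1
  refine lintegral_congr fun x => ?_
  rw [Real.enorm_eq_ofReal (Real.rpow_nonneg (hw x).le _),
    ENNReal.ofReal_rpow_of_nonneg (Real.rpow_nonneg (hw x).le _) hr.le, ← Real.rpow_mul (hw x).le]

/-- `∫⁻ ‖Dφ‖ₑ^2 = ofReal (∫ ‖Dφ‖²)` for `φ ∈ C¹_c`. -/
theorem lintegral_enorm_fderiv_sq {φ : EuclideanSpace ℝ (Fin n) → ℝ} (hφ : ContDiff ℝ 1 φ) (hφc : HasCompactSupport φ) :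
    ∫⁻ y, ‖fderiv ℝ φ y‖ₑ ^ (2 : ℝ) = ENNReal.ofReal (∫ y, ‖fderiv ℝ φ y‖ ^ 2) := by
  have hc : Continuous fun y => ‖fderiv ℝ φ y‖ ^ 2 := ((hφ.continuous_fderiv one_ne_zero).norm).pow 2
  have hs0 : HasCompactSupport (fderiv ℝ φ) := hφc.fderiv (𝕜 := ℝ)
  have hs : HasCompactSupport fun y => ‖fderiv ℝ φ y‖ ^ 2 := by
    refine hs0.norm.mono (Function.support_subset_iff'.2 fun y hy => ?_)
    simp only [Function.mem_support, not_not] at hy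
    simp [hy]
  have hI : Integrable fun y => ‖fderiv ℝ φ y‖ ^ 2 := hc.integrable_of_hasCompactSupport hs
  rw [ofReal_integral_eq_lintegral_ofReal hI (Eventually.of_forall fun y => by positivity)]
  refine lintegral_congr fun y => ?_
  rw [← ofReal_norm, ENNReal.ofReal_rpow_of_nonneg (norm_nonneg _) (by norm_num : (0:ℝ) ≤ 2)]
  norm_num

variable {a : EuclideanSpace ℝ (Fin n) → Matrix (Fin n) (Fin n) ℝ} {lam Λ : ℝ} {w : EuclideanSpace ℝ (Fin n) → ℝ}

/-- **MOSER'S REVERSE HÖLDER STEP** (Moser 1961 §4; Gilbarg–Trudinger, proof of Thm 8.18), `n ≥ 3`, `κ = n/(n−2)`: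
for an entire `C¹` weak solution `w ≥ 1`, `σ = ±1`, `p > 0` with `σp ≠ 1`, `0 < ρ' < ρ`, and a cutoff constant `C₀`
as in `exists_closedBall_cutoff`,
`‖w^σ‖_{L^{pκ}(B̄(x₀,ρ'))} ≤ (C_S² · 2((q/(q−1))²nΛ+λ)/λ · (C₀/(ρ−ρ'))²)^{1/p} ‖w^σ‖_{L^p(B̄(x₀,ρ))}`, `q = σp`,
`C_S` = Mathlib's Sobolev constant `eLpNormLESNormFDerivOfEqInnerConst volume 2`. -/
theorem moser_step (hn : 3 ≤ n) (hsymm : ∀ y, (a y).IsSymm) (hlam : 0 < lam)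
    (hmeas : ∀ i j, Measurable fun y => a y i j)
    (hell : ∀ y (ξ : Fin n → ℝ), lam * (ξ ⬝ᵥ ξ) ≤ ξ ⬝ᵥ (a y *ᵥ ξ)) (hbd : ∀ y i j, |a y i j| ≤ Λ)
    (hw : ContDiff ℝ 1 w) (hw1 : ∀ y, 1 ≤ w y)
    (hweak : ∀ η : EuclideanSpace ℝ (Fin n) → ℝ, ContDiff ℝ 1 η → HasCompactSupport η →
      ∫ y, ∑ i, ∑ j, a y i j * fderiv ℝ w y (EuclideanSpace.single i 1) *
        fderiv ℝ η y (EuclideanSpace.single j 1) = 0)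
    {σ : ℝ} (hσ : σ = 1 ∨ σ = -1) {p : ℝ} (hp : 0 < p) (hq1 : σ * p ≠ 1)
    {C₀ : ℝ} (hcut : ∀ (x₀ : EuclideanSpace ℝ (Fin n)) (ρ' ρ : ℝ), 0 < ρ' → ρ' < ρ →
      ∃ χ : EuclideanSpace ℝ (Fin n) → ℝ, ContDiff ℝ 1 χ ∧ HasCompactSupport χ ∧ (∀ x, 0 ≤ χ x ∧ χ x ≤ 1) ∧
        (∀ x ∈ closedBall x₀ ρ', χ x = 1) ∧ (∀ x, x ∉ ball x₀ ρ → χ x = 0) ∧ ∀ x, ‖fderiv ℝ χ x‖ ≤ C₀ / (ρ - ρ'))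
    (x₀ : EuclideanSpace ℝ (Fin n)) {ρ' ρ : ℝ} (hρ' : 0 < ρ') (hρ : ρ' < ρ) :
    eLpNorm (fun y => w y ^ σ) (ENNReal.ofReal (p * (n / (n - 2 : ℝ)))) (volume.restrict (closedBall x₀ ρ')) ≤
      ENNReal.ofReal ((eLpNormLESNormFDerivOfEqInnerConst (volume : Measure (EuclideanSpace ℝ (Fin n))) 2 : ℝ) ^ 2 *
          (2 * ((σ * p / (σ * p - 1)) ^ 2 * (n * Λ) + lam) / lam * (C₀ / (ρ - ρ')) ^ 2)) ^ (1 / p) *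
        eLpNorm (fun y => w y ^ σ) (ENNReal.ofReal p) (volume.restrict (closedBall x₀ ρ)) := by
  -- notation and positivity
  set q : ℝ := σ * p with hq
  set κ : ℝ := n / (n - 2 : ℝ) with hκ
  set CS : ℝ≥0 := eLpNormLESNormFDerivOfEqInnerConst (volume : Measure (EuclideanSpace ℝ (Fin n))) 2 with hCS
  set M₀ : ℝ := 2 * ((q / (q - 1)) ^ 2 * (n * Λ) + lam) / lam * (C₀ / (ρ - ρ')) ^ 2 with hM₀
  have hn2 : (0 : ℝ) < n - 2 := by
    have : (3 : ℝ) ≤ n := by exact_mod_cast hn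
    linarith
  have hnpos : (0 : ℝ) < n := by linarith
  have hκpos : 0 < κ := by rw [hκ]; positivity
  have hpos : ∀ y, 0 < w y := fun y => lt_of_lt_of_le one_pos (hw1 y)
  have hq0 : q ≠ 0 := by
    rw [hq]; rcases hσ with h | h <;> simp [h, hp.ne']
  have hnΛ : 0 ≤ (n : ℝ) * Λ :=
    mul_nonneg (Nat.cast_nonneg n) ((abs_nonneg _).trans (hbd x₀ ⟨0, by omega⟩ ⟨0, by omega⟩))
  have hM₀nn : 0 ≤ M₀ := by rw [hM₀]; positivity
  -- the cutoff and the test function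
  obtain ⟨χ, hχ, hχc, hχ01, hχ1, hχ0, hχD⟩ := hcut x₀ ρ' ρ hρ' hρ
  have hgC : ContDiff ℝ 1 fun y => w y ^ (q / 2) := contDiff_rpow_of_one_le hw hw1 (q / 2)
  have hφC : ContDiff ℝ 1 fun y => χ y * w y ^ (q / 2) := hχ.mul hgC
  have hφc : HasCompactSupport fun y => χ y * w y ^ (q / 2) := hχc.mul_right (f' := fun y => w y ^ (q / 2))
  -- (E) energy: `λ ∫ ‖Dφ‖² ≤ λ M₀ ∫_{B̄ρ} w^q`
  have hE := energy_testPow_le hsymm hlam hmeas hell hbd hw hw1 hweak hq0 hq1 hχ hχc hχ0 hχD (x₀ := x₀)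
  have hY0 : 0 ≤ ∫ y in closedBall x₀ ρ, w y ^ q :=
    setIntegral_nonneg measurableSet_closedBall fun y _ => Real.rpow_nonneg (hpos y).le _
  have hE' : ∫ y, ‖fderiv ℝ (fun y => χ y * w y ^ (q / 2)) y‖ ^ 2 ≤ M₀ * ∫ y in closedBall x₀ ρ, w y ^ q := by
    rw [← le_div_iff₀' hlam] at hE
    refine hE.trans (le_of_eq ?_)
    rw [hM₀]
    field_simp
  -- (S) Sobolev: `‖φ‖_{2κ} ≤ C_S ‖Dφ‖₂`
  have hfin : finrank ℝ (EuclideanSpace ℝ (Fin n)) = n := finrank_euclideanSpace_fin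
  have hp'inv : ((Real.toNNReal (2 * κ) : ℝ≥0) : ℝ)⁻¹ = (2 : ℝ≥0)⁻¹ - (finrank ℝ (EuclideanSpace ℝ (Fin n)) : ℝ)⁻¹ := by
    rw [Real.coe_toNNReal _ (by positivity), hfin, hκ]
    push_cast
    field_simp
  have hS := eLpNorm_le_eLpNorm_fderiv_of_eq_inner (μ := (volume : Measure (EuclideanSpace ℝ (Fin n)))) hφC hφc
    (p := 2) (p' := Real.toNNReal (2 * κ)) (by norm_num) (by rw [hfin]; omega) hp'inv
  -- (A) `‖Dφ‖₂ ≤ (M₀ · Z)^{1/2}`, `Z = ∫⁻_{B̄ρ} w^q`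
  set Z : ℝ≥0∞ := ∫⁻ y in closedBall x₀ ρ, ENNReal.ofReal (w y ^ q) with hZ
  have hZeq : ENNReal.ofReal (∫ y in closedBall x₀ ρ, w y ^ q) = Z := by
    rw [hZ, ofReal_integral_eq_lintegral_ofReal]
    · exact ((contDiff_rpow_of_one_le hw hw1 q).continuous.continuousOn.integrableOn_compact (isCompact_closedBall _ _))
    · exact Eventually.of_forall fun y => Real.rpow_nonneg (hpos y).le _
  have hA : eLpNorm (fderiv ℝ fun y => χ y * w y ^ (q / 2)) 2 volume ≤ (ENNReal.ofReal M₀ * Z) ^ (1 / 2 : ℝ) := by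
    rw [eLpNorm_eq_lintegral_rpow_enorm_toReal two_ne_zero ENNReal.ofNat_ne_top, ENNReal.toReal_ofNat,
      lintegral_enorm_fderiv_sq hφC hφc]
    refine ENNReal.rpow_le_rpow ?_ (by norm_num)
    rw [← hZeq, ← ENNReal.ofReal_mul hM₀nn]
    exact ENNReal.ofReal_le_ofReal hE'
  -- (B) `X^{1/(2κ)} ≤ ‖φ‖_{2κ}`, `X = ∫⁻_{B̄ρ'} w^{qκ}`
  set X : ℝ≥0∞ := ∫⁻ y in closedBall x₀ ρ', ENNReal.ofReal (w y ^ (q * κ)) with hX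
  have hcoe : ((Real.toNNReal (2 * κ) : ℝ≥0) : ℝ≥0∞) = ENNReal.ofReal (2 * κ) := rfl
  have hB : X ^ (1 / (2 * κ)) ≤ eLpNorm (fun y => χ y * w y ^ (q / 2)) (Real.toNNReal (2 * κ)) volume := by
    have hres : eLpNorm (fun y => χ y * w y ^ (q / 2)) (Real.toNNReal (2 * κ)) (volume.restrict (closedBall x₀ ρ')) ≤
        eLpNorm (fun y => χ y * w y ^ (q / 2)) (Real.toNNReal (2 * κ)) volume :=
      eLpNorm_mono_measure _ Measure.restrict_le_self
    refine le_trans (le_of_eq ?_) hres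
    rw [hcoe, eLpNorm_eq_lintegral_rpow_enorm_toReal (ENNReal.ofReal_pos.2 (by positivity)).ne' ENNReal.ofReal_ne_top,
      ENNReal.toReal_ofReal (by positivity), hX]
    congr 1
    refine setLIntegral_congr_fun measurableSet_closedBall fun y hy => ?_
    rw [hχ1 y hy, one_mul, Real.enorm_eq_ofReal (Real.rpow_nonneg (hpos y).le _),
      ENNReal.ofReal_rpow_of_nonneg (Real.rpow_nonneg (hpos y).le _) (by positivity), ← Real.rpow_mul (hpos y).le]
    congr 2
    ring
  -- (C) combine: `X^{1/(2κ)} ≤ C_S (M₀ Z)^{1/2}`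
  have hC : X ^ (1 / (2 * κ)) ≤ (CS : ℝ≥0∞) * (ENNReal.ofReal M₀ * Z) ^ (1 / 2 : ℝ) :=
    hB.trans (hS.trans (mul_le_mul' le_rfl hA))
  -- (D) raise to the power `2/p` and identify the `eLpNorm`s
  have hD := ENNReal.rpow_le_rpow hC (by positivity : (0 : ℝ) ≤ 2 / p)
  have hL : eLpNorm (fun y => w y ^ σ) (ENNReal.ofReal (p * κ)) (volume.restrict (closedBall x₀ ρ')) =
      (X ^ (1 / (2 * κ))) ^ (2 / p) := by
    rw [eLpNorm_rpow_eq _ hpos σ (by positivity : 0 < p * κ), ← ENNReal.rpow_mul, hX]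
    have h1 : σ * (p * κ) = q * κ := by rw [hq]; ring
    have h2 : 1 / (p * κ) = 1 / (2 * κ) * (2 / p) := by field_simp
    rw [h1, h2]
  have hR : eLpNorm (fun y => w y ^ σ) (ENNReal.ofReal p) (volume.restrict (closedBall x₀ ρ)) = Z ^ (1 / p) := by
    rw [eLpNorm_rpow_eq _ hpos σ hp, hZ]
  have hCS2 : ENNReal.ofReal ((CS : ℝ) ^ 2 * M₀) = (CS : ℝ≥0∞) ^ 2 * ENNReal.ofReal M₀ := by
    rw [ENNReal.ofReal_mul (sq_nonneg _), ENNReal.ofReal_pow (NNReal.coe_nonneg _), ENNReal.ofReal_coe_nnreal]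
  have key : ∀ m z : ℝ≥0∞, ((CS : ℝ≥0∞) * (m * z) ^ (1 / 2 : ℝ)) ^ (2 / p) =
      ((CS : ℝ≥0∞) ^ 2 * m) ^ (1 / p) * z ^ (1 / p) := by
    intro m z
    rw [ENNReal.mul_rpow_of_nonneg _ _ (by positivity : (0 : ℝ) ≤ 2 / p), ← ENNReal.rpow_mul,
      show (1 / 2 : ℝ) * (2 / p) = 1 / p by field_simp,
      ENNReal.mul_rpow_of_nonneg m z (by positivity : (0 : ℝ) ≤ 1 / p),
      ENNReal.mul_rpow_of_nonneg _ m (by positivity : (0 : ℝ) ≤ 1 / p), ← mul_assoc]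
    congr 2
    rw [← ENNReal.rpow_natCast, ← ENNReal.rpow_mul]
    congr 1
    push_cast
    field_simp
  rw [hL, hR, hCS2, ← key]
  exact hD

end Summit.NavierStokesRegularity.NavierStokesRegularity.Theorems.PoloidalWindowDoorPoloidalWindowRigidityDivFormMoserStep

end
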